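import Mathlib
import HarnessLib
import Summits.NavierStokesRegularity.NavierStokesRegularity.Theorems.PoloidalWindowDoorPoloidalWindowRigidityZShockSlopeFunctionAnalytic
import Summits.NavierStokesRegularity.NavierStokesRegularity.Theorems.PoloidalWindowDoorPoloidalWindowRigidityZShockAutonomyPropagation

/-!
# Crux K2 `PoloidalWindowRigidity` (stmt-NavierStokesRegularity-19708), line `z_shock` — L0(c) IN THE ANALYTIC CATEGORY: ONE SLOPE
# FUNCTION ON EVERY CONNECTED NON-DEGENERATE REGION (no hypothesis on level sets)

`--supports stmt-NavierStokesRegularity-19708 --as helper` (leafhand-ns-poloidalwindowdoor-2 g0, 2026-08-31).  **No stub and no summit is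
closed by this file; Navier–Stokes regularity is NOT proved here.**

The card (`Lines/z_shock.md` §«First lemma of R3») names as «L0(c), the honest remainder» the possible MULTI-VALUEDNESS of the slope function
`g̃` across different connected components of a level set `{v₂ = c}`: L0(b) (tree `…ZShockSlopeFunctionPatching`, `…ZShockAutonomyPropagation`)
gives one `g̃` only on regions whose level sets are connected.  This file removes the level-set proviso IN THE ANALYTIC CATEGORY: because the
local slope functions are real-analytic (`…ZShockSlopeFunctionAnalytic`) and `w` is locally onto a neighbourhood of its value (submersion), two
local slope functions that agree near one value agree on the whole overlap of their (interval) domains, and an equivalence-class argument over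
the connected region (`IsPreconnected.induction₂`) glues them: analytic continuation along paths IN `ℝ` has no monodromy.

* `exists_analyticAt_comp_eq_on` — abstract gluing: `Ω` open preconnected; `w` continuous and OPEN at the points of `Ω`
  (`U ∈ 𝓝 x ⇒ w '' U ∈ 𝓝 (w x)`); near every `x ∈ Ω`, `Λ = g_x ∘ w` with `g_x` analytic at `w x` ⇒ ONE `G`, analytic at every value
  `w x`, with `Λ = G ∘ w` on `Ω`;
* `image_mem_nhds_of_fderiv_ne` — a `C¹` function with `Dw(x) e ≠ 0` is open at `x` (Mathlib's `map_nhds_eq_of_surj`);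
* `slope_function_on_connected` — analytic slice `f : ℝ³ → ℝ³`, vanishing minors for `b` (L0(a)), `Ω` open preconnected inside
  `{∂_b f₂ ≠ 0}` ⇒ `∂_z f_b = G(f₂)·∂_b f₂` on `Ω`, `G` analytic at the values;
* `slope_function_both_on_connected` — both components from the wedge law on open preconnected `Ω ⊆ {∇ₕf₂ ≠ 0}`;
* `autonomy_on_connected_of_class_autonomy` — **class entry**: binders of `stub_zShockThickAut` + the LOCAL autonomy clause at `z₀` ⇒ on
  EVERY open connected `Ω ⊆ {∇ₕv₂(t₀,·) ≠ 0}` of the slice ONE real-analytic-at-the-values `G` with `∂_z v_b = G(v₂)·∂_b v₂`, `b ≠ 2`.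

After this file the «globalisation of the local autonomy clause» (L0) holds on each connected component of the non-degenerate set
`{∇ₕv₂(t₀,·) ≠ 0}` of the slice; what is left is only the topology of the degenerate set `{∇ₕv₂ = 0}` (an analytic subset; if it does not
separate the slice, L0 is global).  presearch: «functional dependence, global on connected sets, analytic» — classical; no Mathlib/tree
statement; tools used are Mathlib's `IsPreconnected.induction₂`, `AnalyticOnNhd.eqOn_of_preconnected_of_eventuallyEq`,
`HasStrictFDerivAt.map_nhds_eq_of_surj`. [folklore]
-/

noncomputable section

namespace Summit.NavierStokesRegularity.NavierStokesRegularity.Theorems.PoloidalWindowDoorPoloidalWindowRigidityZShockSlopeFunctionConnected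

-- the problem directory repeats the summit name (`NavierStokesRegularity/NavierStokesRegularity`)
set_option linter.dupNamespace false

open Set Filter Topology Function Metric
open Literature.Analysis Literature.Analysis.FluidPDE
open Summit.NavierStokesRegularity.NavierStokesRegularity.Theorems.PoloidalWindowDoorPoloidalWindowRigidityZShockSlopeFunctionAnalytic
open Summit.NavierStokesRegularity.NavierStokesRegularity.Theorems.PoloidalWindowDoorPoloidalWindowRigidityZShockAutonomyPropagation
  (eq_zero_or_eq_one_of_ne_two)
open Summit.NavierStokesRegularity.NavierStokesRegularity.Theorems.PoloidalWindowDoorPoloidalWindowRigidityZShockAutonomyGlobal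
open Summit.NavierStokesRegularity.NavierStokesRegularity.Theorems.PoloidalWindowDoorPoloidalWindowRigidityConstantShearMeans
  (fderiv_coord_apply)
open Summit.NavierStokesRegularity.NavierStokesRegularity.Theorems.PoloidalWindowDoorPoloidalWindowRigidityHorizontalSourceGauge
  (analyticOnNhd_fderiv_apply_coord)
open Summit.NavierStokesRegularity.NavierStokesRegularity.Theorems.PoloidalWindowDoorPoloidalWindowRigidityLocalFrozenLaw
  (vertShear_wedge_horizGrad_eq_zero)
open Summit.NavierStokesRegularity.NavierStokesRegularity.Theorems.PoloidalWindowDoorPoloidalWindowRigidityWindow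
  (isTypeIAncientMild_of_class)

/-! ## Abstract gluing: analytic local slope functions on a connected region are one function -/

/-- **Gluing analytic local slope functions over a connected region.**  Let `Ω ⊆ X` be open and preconnected, `w : X → ℝ` continuous and
open at the points of `Ω` (`U ∈ 𝓝 x ⇒ w '' U ∈ 𝓝 (w x)`), and suppose that near every `x ∈ Ω` one has `Λ = g_x ∘ w` for some `g_x`
real-analytic at `w x`.  Then there is ONE `G : ℝ → ℝ`, real-analytic at every value `w x` (`x ∈ Ω`), with `Λ = G ∘ w` on `Ω`.
Proof: the relation «`x, y` carry a common analytic slope function on an open interval containing the values near both» is reflexive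
locally, symmetric and transitive (identity theorem on the intersection of two intervals + gluing), hence total on the preconnected `Ω`
(`IsPreconnected.induction₂`). [folklore] -/
theorem exists_analyticAt_comp_eq_on {X : Type*} [TopologicalSpace X] {Λ w : X → ℝ} {Ω : Set X}
    (hΩ : IsPreconnected Ω) (hΩo : IsOpen Ω)
    (hwc : ∀ x ∈ Ω, ContinuousAt w x) (hopen : ∀ x ∈ Ω, ∀ U ∈ 𝓝 x, w '' U ∈ 𝓝 (w x))
    (hloc : ∀ x ∈ Ω, ∃ g : ℝ → ℝ, AnalyticAt ℝ g (w x) ∧ ∀ᶠ x' in 𝓝 x, Λ x' = g (w x')) :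
    ∃ G : ℝ → ℝ, (∀ x ∈ Ω, AnalyticAt ℝ G (w x)) ∧ ∀ x ∈ Ω, Λ x = G (w x) := by
  classical
  -- the relation
  set P : X → X → Prop := fun x y => ∃ (J : Set ℝ) (F : ℝ → ℝ), IsOpen J ∧ IsPreconnected J ∧ AnalyticOnNhd ℝ F J ∧
      (∃ U ∈ 𝓝 x, MapsTo w U J ∧ ∀ x' ∈ U, Λ x' = F (w x')) ∧
      (∃ V ∈ 𝓝 y, MapsTo w V J ∧ ∀ y' ∈ V, Λ y' = F (w y')) with hPdef
  -- local data at a point of `Ω`: an open ball of values and an open neighbourhood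
  have hdata : ∀ x ∈ Ω, ∃ (J : Set ℝ) (F : ℝ → ℝ) (U : Set X), IsOpen J ∧ IsPreconnected J ∧ AnalyticOnNhd ℝ F J ∧
      IsOpen U ∧ x ∈ U ∧ MapsTo w U J ∧ ∀ x' ∈ U, Λ x' = F (w x') := by
    intro x hx
    obtain ⟨g, hgA, hg⟩ := hloc x hx
    obtain ⟨r, hr, hball⟩ := Metric.mem_nhds_iff.1 hgA.eventually_analyticAt
    have h1 : ∀ᶠ x' in 𝓝 x, w x' ∈ ball (w x) r := (hwc x hx).preimage_mem_nhds (ball_mem_nhds _ hr)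
    obtain ⟨U, hUsub, hUo, hxU⟩ := _root_.mem_nhds_iff.1 (hg.and h1)
    exact ⟨ball (w x) r, g, U, isOpen_ball, (convex_ball (w x) r).isPreconnected, fun s hs => hball hs, hUo, hxU,
      fun x' hx' => (hUsub hx').2, fun x' hx' => (hUsub hx').1⟩
  -- reflexive locally
  have hrefl : ∀ x ∈ Ω, ∀ᶠ y in 𝓝[Ω] x, P x y := by
    intro x hx
    obtain ⟨J, F, U, hJo, hJc, hF, hUo, hxU, hwU, hΛU⟩ := hdata x hx
    refine mem_nhdsWithin_of_mem_nhds ?_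
    filter_upwards [hUo.mem_nhds hxU] with y hy
    exact ⟨J, F, hJo, hJc, hF, ⟨U, hUo.mem_nhds hxU, hwU, hΛU⟩, ⟨U, hUo.mem_nhds hy, hwU, hΛU⟩⟩
  -- symmetric
  have hsymm : ∀ x y, x ∈ Ω → y ∈ Ω → P x y → P y x := by
    rintro x y - - ⟨J, F, hJo, hJc, hF, hU, hV⟩
    exact ⟨J, F, hJo, hJc, hF, hV, hU⟩
  -- transitive: identity theorem on `J₁ ∩ J₂`, then glue
  have htrans : ∀ x y z, x ∈ Ω → y ∈ Ω → z ∈ Ω → P x y → P y z → P x z := by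
    rintro x y z - hy - ⟨J₁, F₁, hJ₁o, hJ₁c, hF₁, ⟨U₁, hU₁, hwU₁, hΛU₁⟩, ⟨V₁, hV₁, hwV₁, hΛV₁⟩⟩
      ⟨J₂, F₂, hJ₂o, hJ₂c, hF₂, ⟨U₂, hU₂, hwU₂, hΛU₂⟩, ⟨V₂, hV₂, hwV₂, hΛV₂⟩⟩
    -- `F₁ = F₂` near `w y`
    have hyJ₁ : w y ∈ J₁ := hwV₁ (mem_of_mem_nhds hV₁)
    have hyJ₂ : w y ∈ J₂ := hwU₂ (mem_of_mem_nhds hU₂)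
    have hnear : F₁ =ᶠ[𝓝 (w y)] F₂ := by
      have him : w '' (V₁ ∩ U₂) ∈ 𝓝 (w y) := hopen y hy _ (inter_mem hV₁ hU₂)
      filter_upwards [him] with c hc
      obtain ⟨y', hy', rfl⟩ := hc
      rw [← hΛV₁ y' hy'.1, ← hΛU₂ y' hy'.2]
    -- hence on the interval `J₁ ∩ J₂`
    have hI : IsPreconnected (J₁ ∩ J₂) :=
      ((isPreconnected_iff_ordConnected.1 hJ₁c).inter (isPreconnected_iff_ordConnected.1 hJ₂c)).isPreconnected
    have hEq : EqOn F₁ F₂ (J₁ ∩ J₂) :=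
      (hF₁.mono inter_subset_left).eqOn_of_preconnected_of_eventuallyEq (hF₂.mono inter_subset_right) hI
        ⟨hyJ₁, hyJ₂⟩ hnear
    -- the glued function
    set F : ℝ → ℝ := fun s => if s ∈ J₁ then F₁ s else F₂ s with hFdef
    have hF1 : ∀ s ∈ J₁, F s = F₁ s := fun s hs => by simp [hFdef, hs]
    have hF2 : ∀ s ∈ J₂, F s = F₂ s := by
      intro s hs
      by_cases h1 : s ∈ J₁
      · rw [hF1 s h1]; exact hEq ⟨h1, hs⟩
      · simp [hFdef, h1]
    have hFan : AnalyticOnNhd ℝ F (J₁ ∪ J₂) := by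
      intro s hs
      rcases hs with h1 | h2
      · refine (hF₁ s h1).congr ?_
        filter_upwards [hJ₁o.mem_nhds h1] with s' hs'
        exact (hF1 s' hs').symm
      · refine (hF₂ s h2).congr ?_
        filter_upwards [hJ₂o.mem_nhds h2] with s' hs'
        exact (hF2 s' hs').symm
    refine ⟨J₁ ∪ J₂, F, hJ₁o.union hJ₂o, IsPreconnected.union (w y) hyJ₁ hyJ₂ hJ₁c hJ₂c, hFan,
      ⟨U₁, hU₁, fun x' hx' => Or.inl (hwU₁ hx'), fun x' hx' => ?_⟩,
      ⟨V₂, hV₂, fun y' hy' => Or.inr (hwV₂ hy'), fun y' hy' => ?_⟩⟩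
    · rw [hF1 _ (hwU₁ hx')]; exact hΛU₁ x' hx'
    · rw [hF2 _ (hwV₂ hy')]; exact hΛV₂ y' hy'
  -- so `P x y` for all `x, y ∈ Ω`; in particular `Λ` is a function of `w` on `Ω`
  have hP : ∀ x y, x ∈ Ω → y ∈ Ω → P x y := fun x y hx hy => hΩ.induction₂ P hrefl htrans hsymm hx hy
  have hconst : ∀ x y, x ∈ Ω → y ∈ Ω → w x = w y → Λ x = Λ y := by
    intro x y hx hy hw
    obtain ⟨J, F, -, -, -, ⟨U, hU, -, hΛU⟩, ⟨V, hV, -, hΛV⟩⟩ := hP x y hx hy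
    rw [hΛU x (mem_of_mem_nhds hU), hΛV y (mem_of_mem_nhds hV), hw]
  -- the global function, by choice
  set G : ℝ → ℝ := fun c => if h : ∃ x ∈ Ω, w x = c then Λ h.choose else 0 with hGdef
  have hG : ∀ x ∈ Ω, Λ x = G (w x) := by
    intro x hx
    have h : ∃ x' ∈ Ω, w x' = w x := ⟨x, hx, rfl⟩
    simp only [hGdef]
    rw [dif_pos h]
    exact hconst x h.choose hx h.choose_spec.1 h.choose_spec.2.symm
  refine ⟨G, fun x hx => ?_, hG⟩
  -- analyticity at `w x`: `G = g_x` on the image of a neighbourhood of `x` inside `Ω`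
  obtain ⟨g, hgA, hg⟩ := hloc x hx
  refine hgA.congr ?_
  have him : w '' ({x' | Λ x' = g (w x')} ∩ Ω) ∈ 𝓝 (w x) := hopen x hx _ (inter_mem hg (hΩo.mem_nhds hx))
  filter_upwards [him] with c hc
  obtain ⟨x', ⟨hx'g, hx'Ω⟩, rfl⟩ := hc
  rw [← hx'g, hG x' hx'Ω]

/-- **A `C¹` function with `Dw(x) e ≠ 0` is open at `x`** (from Mathlib's `HasStrictFDerivAt.map_nhds_eq_of_surj`: a real functional with
a non-zero value is onto). [folklore] -/
theorem image_mem_nhds_of_fderiv_ne {E : Type*} [NormedAddCommGroup E] [NormedSpace ℝ E] [CompleteSpace E] {w : E → ℝ} {x e : E}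
    (hw : ContDiffAt ℝ 1 w x) (he : fderiv ℝ w x e ≠ 0) {U : Set E} (hU : U ∈ 𝓝 x) : w '' U ∈ 𝓝 (w x) := by
  have hstrict : HasStrictFDerivAt w (fderiv ℝ w x) x := hw.hasStrictFDerivAt one_ne_zero
  have hsurj : (fderiv ℝ w x).range = ⊤ := by
    refine LinearMap.range_eq_top.2 fun c => ⟨(c / fderiv ℝ w x e) • e, ?_⟩
    simp only [map_smul, smul_eq_mul, ContinuousLinearMap.coe_coe]
    exact div_mul_cancel₀ c he
  rw [← hstrict.map_nhds_eq_of_surj hsurj]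
  exact image_mem_map hU

/-! ## The analytic slice -/

/-- **One analytic slope function on every connected non-degenerate region (one component).**  `f : ℝ³ → ℝ³` real-analytic, `b : Fin 3`,
minors of `(∂_b f₂·∇(∂_z f_b) − ∂_z f_b·∇(∂_b f₂), ∇f₂)` vanish everywhere (L0(a)); `Ω` open, preconnected, `∂_b f₂ ≠ 0` on `Ω` ⇒ ONE `G`,
real-analytic at the values `f₂(x)`, `x ∈ Ω`, with `∂_z f_b = G(f₂)·∂_b f₂` on `Ω`.  No hypothesis on the level sets of `f₂`. [folklore] -/
theorem slope_function_on_connected {f : EuclideanSpace ℝ (Fin 3) → EuclideanSpace ℝ (Fin 3)}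
    (hf : AnalyticOnNhd ℝ f univ) {b : Fin 3}
    (hminor : ∀ x u u' : EuclideanSpace ℝ (Fin 3),
      (fderiv ℝ f x (EuclideanSpace.single b 1) 2 *
            fderiv ℝ (fun y => fderiv ℝ f y (EuclideanSpace.single 2 1) b) x u -
          fderiv ℝ f x (EuclideanSpace.single 2 1) b *
            fderiv ℝ (fun y => fderiv ℝ f y (EuclideanSpace.single b 1) 2) x u) *
          fderiv ℝ (fun y => f y 2) x u' -
        (fderiv ℝ f x (EuclideanSpace.single b 1) 2 *
            fderiv ℝ (fun y => fderiv ℝ f y (EuclideanSpace.single 2 1) b) x u' -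
          fderiv ℝ f x (EuclideanSpace.single 2 1) b *
            fderiv ℝ (fun y => fderiv ℝ f y (EuclideanSpace.single b 1) 2) x u') *
          fderiv ℝ (fun y => f y 2) x u = 0)
    {Ω : Set (EuclideanSpace ℝ (Fin 3))} (hΩ : IsPreconnected Ω) (hΩo : IsOpen Ω)
    (hΩnd : ∀ x ∈ Ω, fderiv ℝ f x (EuclideanSpace.single b 1) 2 ≠ 0) :
    ∃ G : ℝ → ℝ, (∀ x ∈ Ω, AnalyticAt ℝ G (f x 2)) ∧ ∀ x ∈ Ω, fderiv ℝ f x (EuclideanSpace.single 2 1) b =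
      G (f x 2) * fderiv ℝ f x (EuclideanSpace.single b 1) 2 := by
  set N : EuclideanSpace ℝ (Fin 3) → ℝ := fun y => fderiv ℝ f y (EuclideanSpace.single 2 1) b with hNdef
  set D : EuclideanSpace ℝ (Fin 3) → ℝ := fun y => fderiv ℝ f y (EuclideanSpace.single b 1) 2 with hDdef
  set w : EuclideanSpace ℝ (Fin 3) → ℝ := fun y => f y 2 with hwdef
  have hD : AnalyticOnNhd ℝ D univ := analyticOnNhd_fderiv_apply_coord hf _ _
  have hw : AnalyticOnNhd ℝ w univ := analyticOnNhd_coord hf 2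
  have hDw : ∀ y, D y = fderiv ℝ w y (EuclideanSpace.single b 1) := by
    intro y
    simp only [hwdef, hDdef, fderiv_coord_apply (hf y (mem_univ _)).differentiableAt]
  -- the slope `Λ = N / D` is locally an analytic function of `w` at points of `Ω`
  obtain ⟨G, hGA, hG⟩ := exists_analyticAt_comp_eq_on (Λ := fun y => N y / D y) (w := w) hΩ hΩo
    (fun x _ => (hw x (mem_univ _)).continuousAt)
    (fun x hx U hU => image_mem_nhds_of_fderiv_ne (e := EuclideanSpace.single b 1) (hw x (mem_univ _)).contDiffAt
      (by rw [← hDw]; exact hΩnd x hx) hU)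
    (fun x hx => by
      obtain ⟨g, U, hUo, hxU, hgA, hgU⟩ := exists_analytic_slope_function_near_of_analytic hf hminor (hΩnd x hx)
      refine ⟨g, hgA x hxU, ?_⟩
      have hDne : ∀ᶠ x' in 𝓝 x, D x' ≠ 0 := (hD x (mem_univ _)).continuousAt.eventually_ne (hΩnd x hx)
      filter_upwards [hUo.mem_nhds hxU, hDne] with x' hx' hDx'
      change fderiv ℝ f x' (EuclideanSpace.single 2 1) b / fderiv ℝ f x' (EuclideanSpace.single b 1) 2 = g (f x' 2)
      rw [hgU x' hx']
      exact mul_div_cancel_right₀ _ hDx')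
  refine ⟨G, hGA, fun x hx => ?_⟩
  have h := hG x hx
  change N x / D x = G (w x) at h
  show N x = G (w x) * D x
  rw [← h]
  exact (div_mul_cancel₀ (N x) (hΩnd x hx : D x ≠ 0)).symm

/-- **Both horizontal components, one analytic slope function, on every connected region where `∇ₕf₂ ≠ 0`.**  Analytic `f`, wedge law
`∂_z f₀·∂₁f₂ = ∂_z f₁·∂₀f₂` everywhere, vanishing minors for `b = 0, 1` (L0(a)); `Ω` open preconnected with `∇ₕf₂ ≠ 0` on `Ω` ⇒ ONE `G`,
analytic at the values, with `∂_z f_b = G(f₂)·∂_b f₂` on `Ω` for every `b ≠ 2`. [folklore] -/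
theorem slope_function_both_on_connected {f : EuclideanSpace ℝ (Fin 3) → EuclideanSpace ℝ (Fin 3)}
    (hf : AnalyticOnNhd ℝ f univ)
    (hwedge : ∀ x : EuclideanSpace ℝ (Fin 3),
      fderiv ℝ f x (EuclideanSpace.single 2 1) 0 * fderiv ℝ f x (EuclideanSpace.single 1 1) 2 -
        fderiv ℝ f x (EuclideanSpace.single 2 1) 1 * fderiv ℝ f x (EuclideanSpace.single 0 1) 2 = 0)
    (hminor : ∀ b : Fin 3, b ≠ 2 → ∀ x u u' : EuclideanSpace ℝ (Fin 3),
      (fderiv ℝ f x (EuclideanSpace.single b 1) 2 *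
            fderiv ℝ (fun y => fderiv ℝ f y (EuclideanSpace.single 2 1) b) x u -
          fderiv ℝ f x (EuclideanSpace.single 2 1) b *
            fderiv ℝ (fun y => fderiv ℝ f y (EuclideanSpace.single b 1) 2) x u) *
          fderiv ℝ (fun y => f y 2) x u' -
        (fderiv ℝ f x (EuclideanSpace.single b 1) 2 *
            fderiv ℝ (fun y => fderiv ℝ f y (EuclideanSpace.single 2 1) b) x u' -
          fderiv ℝ f x (EuclideanSpace.single 2 1) b *
            fderiv ℝ (fun y => fderiv ℝ f y (EuclideanSpace.single b 1) 2) x u') *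
          fderiv ℝ (fun y => f y 2) x u = 0)
    {Ω : Set (EuclideanSpace ℝ (Fin 3))} (hΩ : IsPreconnected Ω) (hΩo : IsOpen Ω)
    (hΩnd : ∀ x ∈ Ω, fderiv ℝ f x (EuclideanSpace.single 0 1) 2 ≠ 0 ∨ fderiv ℝ f x (EuclideanSpace.single 1 1) 2 ≠ 0) :
    ∃ G : ℝ → ℝ, (∀ x ∈ Ω, AnalyticAt ℝ G (f x 2)) ∧ ∀ x ∈ Ω, ∀ b : Fin 3, b ≠ 2 →
      fderiv ℝ f x (EuclideanSpace.single 2 1) b = G (f x 2) * fderiv ℝ f x (EuclideanSpace.single b 1) 2 := by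
  set N0 : EuclideanSpace ℝ (Fin 3) → ℝ := fun y => fderiv ℝ f y (EuclideanSpace.single 2 1) 0 with hN0
  set N1 : EuclideanSpace ℝ (Fin 3) → ℝ := fun y => fderiv ℝ f y (EuclideanSpace.single 2 1) 1 with hN1
  set D0 : EuclideanSpace ℝ (Fin 3) → ℝ := fun y => fderiv ℝ f y (EuclideanSpace.single 0 1) 2 with hD0
  set D1 : EuclideanSpace ℝ (Fin 3) → ℝ := fun y => fderiv ℝ f y (EuclideanSpace.single 1 1) 2 with hD1
  set w : EuclideanSpace ℝ (Fin 3) → ℝ := fun y => f y 2 with hwdef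
  have hD0a : AnalyticOnNhd ℝ D0 univ := analyticOnNhd_fderiv_apply_coord hf _ _
  have hD1a : AnalyticOnNhd ℝ D1 univ := analyticOnNhd_fderiv_apply_coord hf _ _
  have hw : AnalyticOnNhd ℝ w univ := analyticOnNhd_coord hf 2
  have hDw : ∀ (c : Fin 3) (y : EuclideanSpace ℝ (Fin 3)),
      fderiv ℝ f y (EuclideanSpace.single c 1) 2 = fderiv ℝ w y (EuclideanSpace.single c 1) := by
    intro c y
    simp only [hwdef, fderiv_coord_apply (hf y (mem_univ _)).differentiableAt]
  -- the common slope
  set Λ : EuclideanSpace ℝ (Fin 3) → ℝ := fun y => (N0 y * D0 y + N1 y * D1 y) / (D0 y ^ 2 + D1 y ^ 2) with hΛ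
  have hpos : ∀ x, D0 x ≠ 0 ∨ D1 x ≠ 0 → D0 x ^ 2 + D1 x ^ 2 ≠ 0 := by
    intro x hx
    rcases hx with h | h
    · have : 0 < D0 x ^ 2 := by positivity
      positivity
    · have : 0 < D1 x ^ 2 := by positivity
      positivity
  have hΛeq : ∀ (x : EuclideanSpace ℝ (Fin 3)) (c : ℝ), D0 x ^ 2 + D1 x ^ 2 ≠ 0 →
      N0 x = c * D0 x → N1 x = c * D1 x → Λ x = c := by
    intro x c hx h0 h1
    simp only [hΛ, h0, h1]
    field_simp
  -- local analytic slope functions for the common slope, from one component and the wedge law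
  have hloc : ∀ x ∈ Ω, ∃ g : ℝ → ℝ, AnalyticAt ℝ g (w x) ∧ ∀ᶠ x' in 𝓝 x, Λ x' = g (w x') := by
    intro x hx
    rcases hΩnd x hx with h0 | h1
    · obtain ⟨g, U, hUo, hxU, hgA, hgU⟩ := exists_analytic_slope_function_near_of_analytic hf (hminor 0 (by decide)) h0
      refine ⟨g, hgA x hxU, ?_⟩
      have hne : ∀ᶠ x' in 𝓝 x, D0 x' ≠ 0 := (hD0a x (mem_univ _)).continuousAt.eventually_ne h0
      filter_upwards [hUo.mem_nhds hxU, hne] with x' hx' hD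
      have hg0 : N0 x' = g (w x') * D0 x' := hgU x' hx'
      have hg1 : N1 x' = g (w x') * D1 x' := by
        have hwx := hwedge x'
        have : N1 x' * D0 x' = g (w x') * D1 x' * D0 x' := by
          linear_combination (-1 : ℝ) * hwx + D1 x' * hg0
        exact mul_right_cancel₀ hD this
      exact hΛeq x' _ (hpos x' (Or.inl hD)) hg0 hg1
    · obtain ⟨g, U, hUo, hxU, hgA, hgU⟩ := exists_analytic_slope_function_near_of_analytic hf (hminor 1 (by decide)) h1
      refine ⟨g, hgA x hxU, ?_⟩
      have hne : ∀ᶠ x' in 𝓝 x, D1 x' ≠ 0 := (hD1a x (mem_univ _)).continuousAt.eventually_ne h1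
      filter_upwards [hUo.mem_nhds hxU, hne] with x' hx' hD
      have hg1 : N1 x' = g (w x') * D1 x' := hgU x' hx'
      have hg0 : N0 x' = g (w x') * D0 x' := by
        have hwx := hwedge x'
        have : N0 x' * D1 x' = g (w x') * D0 x' * D1 x' := by
          linear_combination hwx + D0 x' * hg1
        exact mul_right_cancel₀ hD this
      exact hΛeq x' _ (hpos x' (Or.inr hD)) hg0 hg1
  -- `w` is open at the points of `Ω`
  have hopen : ∀ x ∈ Ω, ∀ U ∈ 𝓝 x, w '' U ∈ 𝓝 (w x) := by
    intro x hx U hU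
    rcases hΩnd x hx with h0 | h1
    · exact image_mem_nhds_of_fderiv_ne (e := EuclideanSpace.single 0 1) (hw x (mem_univ _)).contDiffAt
        (by rw [← hDw]; exact h0) hU
    · exact image_mem_nhds_of_fderiv_ne (e := EuclideanSpace.single 1 1) (hw x (mem_univ _)).contDiffAt
        (by rw [← hDw]; exact h1) hU
  obtain ⟨G, hGA, hG⟩ := exists_analyticAt_comp_eq_on hΩ hΩo (fun x _ => (hw x (mem_univ _)).continuousAt) hopen hloc
  refine ⟨G, hGA, fun x hx b hb => ?_⟩
  -- at `x`: `N_b = g_x D_b` locally and `Λ x = g_x (w x) = G (w x)`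
  obtain ⟨g, -, hg⟩ := hloc x hx
  have hΛx : Λ x = G (w x) := hG x hx
  -- recover `N_b x = Λ x * D_b x` from the wedge law and non-degeneracy
  have hsum : N0 x * D0 x + N1 x * D1 x = Λ x * (D0 x ^ 2 + D1 x ^ 2) := by
    simp only [hΛ]
    field_simp [hpos x (hΩnd x hx)]
  have hwx := hwedge x
  rcases eq_zero_or_eq_one_of_ne_two hb with rfl | rfl
  · -- `N0 (D0² + D1²) = (N0 D0 + N1 D1) D0` by the wedge law
    have key : N0 x * (D0 x ^ 2 + D1 x ^ 2) = Λ x * (D0 x ^ 2 + D1 x ^ 2) * D0 x := by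
      have : N0 x * (D0 x ^ 2 + D1 x ^ 2) = (N0 x * D0 x + N1 x * D1 x) * D0 x := by
        linear_combination D1 x * hwx
      rw [this, hsum]
    have h2 : N0 x = Λ x * D0 x := by
      have hne := hpos x (hΩnd x hx)
      have : N0 x * (D0 x ^ 2 + D1 x ^ 2) = (Λ x * D0 x) * (D0 x ^ 2 + D1 x ^ 2) := by rw [key]; ring
      exact mul_right_cancel₀ hne this
    show N0 x = G (w x) * D0 x
    rw [h2, hΛx]
  · have key : N1 x * (D0 x ^ 2 + D1 x ^ 2) = Λ x * (D0 x ^ 2 + D1 x ^ 2) * D1 x := by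
      have : N1 x * (D0 x ^ 2 + D1 x ^ 2) = (N0 x * D0 x + N1 x * D1 x) * D1 x := by
        linear_combination (-D0 x) * hwx
      rw [this, hsum]
    have h2 : N1 x = Λ x * D1 x := by
      have hne := hpos x (hΩnd x hx)
      have : N1 x * (D0 x ^ 2 + D1 x ^ 2) = (Λ x * D1 x) * (D0 x ^ 2 + D1 x ^ 2) := by rw [key]; ring
      exact mul_right_cancel₀ hne this
    show N1 x = G (w x) * D1 x
    rw [h2, hΛx]

/-! ## Class entry -/

/-- **L0 on connected non-degenerate regions, for the route's class.**  Class binders of `stub_zShockThickAut` (Type-I rate, continuity on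
the slab, unit-viscosity Oseen identity, divergence-free, poloidal) + the stub's LOCAL autonomy clause at `z₀ ∈ W₁` ⇒ on EVERY open connected
set `Ω` of the slice `t₀ = z₀.1` on which `∇ₕv₂(t₀,·) ≠ 0` there is ONE `G : ℝ → ℝ`, real-analytic at the values `v₂(t₀,x)` (`x ∈ Ω`), with
`∂_z v_b = G(v₂)·∂_b v₂` on `Ω` for every `b ≠ 2`.  No hypothesis on level sets (L0(c) in the analytic category); what remains global is
only whether the analytic degenerate set `{∇ₕv₂ = 0}` separates the slice. [folklore] -/
theorem autonomy_on_connected_of_class_autonomy (C : ℝ) (v : ℝ → EuclideanSpace ℝ (Fin 3) → EuclideanSpace ℝ (Fin 3))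
    (hrate : Literature.Analysis.FluidPDE.HasTypeITimeDecay C v)
    (hcont : ContinuousOn (Function.uncurry v) (Set.Iio (0 : ℝ) ×ˢ Set.univ))
    (hmild : ∀ s t : ℝ, s < t → t < 0 → ∀ x, v t x =
      Literature.Analysis.UnboundedOperators.heatExtension (v s) (t - s) x -
        Literature.Analysis.FluidPDE.oseenDuhamel 1 s v v t x)
    (hdiv : ∀ t < 0, Literature.Analysis.FluidPDE.VectorCalculus.IsDivFree (v t))
    (hpol : ∀ s < 0, ∀ y, inner ℝ (Literature.Analysis.FluidPDE.curl (v s) y) (EuclideanSpace.single 2 1) = 0)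
    {W₁ : Set (ℝ × EuclideanSpace ℝ (Fin 3))} (hW₁ : IsOpen W₁) (hW₁s : W₁ ⊆ Set.Iio (0 : ℝ) ×ˢ Set.univ)
    {z₀ : ℝ × EuclideanSpace ℝ (Fin 3)} (hz₀ : z₀ ∈ W₁) {g : ℝ → ℝ → ℝ}
    (haut : ∀ z ∈ W₁, ∀ b : Fin 3, b ≠ 2 →
      fderiv ℝ (v z.1) z.2 (EuclideanSpace.single 2 1) b =
        g z.1 (v z.1 z.2 2) * fderiv ℝ (v z.1) z.2 (EuclideanSpace.single b 1) 2)
    {Ω : Set (EuclideanSpace ℝ (Fin 3))} (hΩ : IsPreconnected Ω) (hΩo : IsOpen Ω)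
    (hΩnd : ∀ x ∈ Ω, fderiv ℝ (v z₀.1) x (EuclideanSpace.single 0 1) 2 ≠ 0 ∨
      fderiv ℝ (v z₀.1) x (EuclideanSpace.single 1 1) 2 ≠ 0) :
    ∃ G : ℝ → ℝ, (∀ x ∈ Ω, AnalyticAt ℝ G (v z₀.1 x 2)) ∧ ∀ x ∈ Ω, ∀ b : Fin 3, b ≠ 2 →
      fderiv ℝ (v z₀.1) x (EuclideanSpace.single 2 1) b =
        G (v z₀.1 x 2) * fderiv ℝ (v z₀.1) x (EuclideanSpace.single b 1) 2 := by
  have ht₀ : z₀.1 < 0 := (Set.mem_prod.1 (hW₁s hz₀)).1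
  have hbdd : ∀ δ : ℝ, 0 < δ → ∃ B : ℝ, ∀ t < -δ, ∀ y : EuclideanSpace ℝ (Fin 3), ‖v t y‖ ≤ B := by
    intro δ hδ
    refine ⟨|C| / Real.sqrt δ, fun t ht y => ?_⟩
    have hδt : δ ≤ -t := by linarith
    have hsq : Real.sqrt δ ≤ Real.sqrt (-t) := Real.sqrt_le_sqrt hδt
    have hsqpos : 0 < Real.sqrt δ := Real.sqrt_pos.2 hδ
    calc ‖v t y‖ ≤ C / Real.sqrt (-t) := hrate t (by linarith) y
      _ ≤ |C| / Real.sqrt (-t) := by gcongr; exact le_abs_self C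
      _ ≤ |C| / Real.sqrt δ := by gcongr
  have han : AnalyticOnNhd ℝ (v z₀.1) univ :=
    Literature.Analysis.NavierStokesZoomKit.LocalSineTubeDoorProfileAlignedWindowRigidityAncient.analyticOnNhd_slice
      hcont hbdd hmild ht₀
  obtain ⟨q, hq⟩ := exists_isClassicalNSSolutionOn_Iio_of_isTypeIAncientMild (isTypeIAncientMild_of_class hrate hcont hmild hdiv)
  have hslab : IsOpen (Set.Iio (0 : ℝ) ×ˢ (Set.univ : Set (EuclideanSpace ℝ (Fin 3)))) := isOpen_Iio.prod isOpen_univ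
  have hpol' : ∀ p ∈ Set.Iio (0 : ℝ) ×ˢ (Set.univ : Set (EuclideanSpace ℝ (Fin 3))),
      inner ℝ (curl (v p.1) p.2) (EuclideanSpace.single 2 (1 : ℝ)) = 0 :=
    fun p hp => hpol p.1 (Set.mem_prod.1 hp).1 p.2
  have hwedge : ∀ y : EuclideanSpace ℝ (Fin 3),
      fderiv ℝ (v z₀.1) y (EuclideanSpace.single 2 1) 0 * fderiv ℝ (v z₀.1) y (EuclideanSpace.single 1 1) 2 -
        fderiv ℝ (v z₀.1) y (EuclideanSpace.single 2 1) 1 * fderiv ℝ (v z₀.1) y (EuclideanSpace.single 0 1) 2 = 0 :=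
    fun y => vertShear_wedge_horizGrad_eq_zero hslab hq.onRegion hpol' (p := (z₀.1, y)) (Set.mk_mem_prod ht₀ (Set.mem_univ y))
  exact slope_function_both_on_connected han hwedge
    (fun b hb y u u' => minors_eq_zero_of_class_autonomy C v hrate hcont hmild hW₁ hW₁s hz₀ haut hb y u u') hΩ hΩo hΩnd

end Summit.NavierStokesRegularity.NavierStokesRegularity.Theorems.PoloidalWindowDoorPoloidalWindowRigidityZShockSlopeFunctionConnected

end
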